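import Summits.Ventures.HodgeRepro2.T5FinitePlaceIsometryCriterion
import Summits.Ventures.HodgeRepro2.T5HermitianTwoClasses
import Summits.Ventures.HodgeRepro2.T5LocalNormIndex

/-!
# `(F_v^× : N E_w^×) = 2` on the route's completions: file 140's `IndexTwo E_w` from seat p4's local norm index
theorem (cell pub-hodge-repro2, seat p3)

Tier-5 N2 support, row N2.2.2 of route/T5-N2-route-3.md. Files 136 / 139 / 140 of this seat proved Shimura's
Lemma 1.6, row N2.8.1 (i) and HKS96's «precisely two isomorphism classes in each dimension» on `E_w` MODULO two
binders: `(U) = BinaryUniversal E_w` and `IndexTwo E_w` («the product of two star-fixed non-zero non-norms is a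
norm», O'Meara 63:13a / local class field theory). Seat p4's chain (`T5AdicCompletionNormGroup` at an inert place,
`T5QuadraticNormIndex` at a ramified place of any residue characteristic, merged in
`T5LocalNormIndex.index_normGroup_eq_two`) proves `[Kᵥˣ : N L_wˣ] = 2` for every quadratic extension of
completions `L_w / Kᵥ` with its non-trivial automorphism `σ`. This file is the CONCORDANCE of the two vocabularies
and discharges `IndexTwo E_w` in kernel at EVERY finite non-split place:

* `algebraMap_eq_completionMap'`: p4's global algebra `Kᵥ → L_w` (`T5AdicCompletionMap.instAlgebra`) and this
  seat's `completionMap` (file 115; scoped instance, NOT opened here) are the same ring homomorphism — both are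
  continuous and restrict to `algebraMap K L` on the dense subfield `K`; `instAlgebra_eq` (the two `Algebra`
  structures are equal); `finrank_eq_two'` (file 116's `[E_w : F_v] = 2` transported to p4's structure);
* `localConj`: file 117's local conjugation `extendAutOfNotIsSquare` as an automorphism of `L_w` over p4's
  `Kᵥ`-algebra, with `localConj_eq_star` (it is file 119's `star`) and `localConj_ne_one`;
* `isUnitNorm_iff_mem_normGroup`: file 134's `IsUnitNorm (alg y)` is `y ∈ normGroup v w localConj`;
* **`indexTwo : IndexTwo E_w`** — p4's index theorem through `Subgroup.mul_mem_iff_of_index_two`;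
* `exists_star_eq_self_not_isUnitNorm` (a star-fixed non-zero non-norm exists, `normGroup ≠ ⊤`) and
  **`exists_two_classes_local`**: HKS96's two classes on `E_w` modulo `(U)` ALONE, in every dimension `≥ 1`.

Nothing is displayed: `IndexTwo E_w` is now a theorem of this tree; `(U)` stays the one binder of this line.
Mathlib + files 115–119, 133–140 (this seat) + `T5LocalNormIndex` and its imports (seat p4) only.
§8(d): uses an L-value-free non-vanishing device: NO.
-/

namespace Summit.Ventures.HodgeRepro2.T5FinitePlaceNormIndex

open IsDedekindDomain IsDedekindDomain.HeightOneSpectrum NumberField Module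
open Summit.Ventures.HodgeRepro2.T5FinitePlaceTensorEquiv
  Summit.Ventures.HodgeRepro2.T5FinitePlaceStar Summit.Ventures.HodgeRepro2.T5FinitePlaceIsometryCriterion
  Summit.Ventures.HodgeRepro2.T5HermitianDetClass Summit.Ventures.HodgeRepro2.T5HermitianClassify
  Summit.Ventures.HodgeRepro2.T5HermitianTwoClasses Summit.Ventures.HodgeRepro2.T5AdicCompletionNormGroup
  Summit.Ventures.HodgeRepro2.T5LocalNormIndex

/-! The namespace `T5FinitePlaceLiesOver` is deliberately NOT opened in this file (an `open` would activate its
scoped instance): every `algebraMap (v.adicCompletion F) (w.adicCompletion E)` below is seat p4's global instance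
`T5AdicCompletionMap.instAlgebra F E v w`; this seat's structure map appears by its full name
`T5FinitePlaceLiesOver.completionMap F E v w`. -/

section Concordance

variable {F E : Type*} [Field F] [NumberField F] [Field E] [NumberField E] [Algebra F E]
variable (v : HeightOneSpectrum (𝓞 F)) (w : HeightOneSpectrum (𝓞 E)) [w.asIdeal.LiesOver v.asIdeal]

/-- p4's structure map `Kᵥ → L_w` restricted to `K` is `algebraMap K L` (both scalar towers). -/
theorem algebraMap_coe (k : F) :
    algebraMap (v.adicCompletion F) (w.adicCompletion E) (k : v.adicCompletion F) =
      ((algebraMap F E k : E) : w.adicCompletion E) := by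
  rw [show (k : v.adicCompletion F) = algebraMap F (v.adicCompletion F) k from rfl,
    show ((algebraMap F E k : E) : w.adicCompletion E) = algebraMap E (w.adicCompletion E) (algebraMap F E k)
      from rfl, ← IsScalarTower.algebraMap_apply, ← IsScalarTower.algebraMap_apply]

/-- **Concordance of the two structure maps `Kᵥ → L_w`:** seat p4's `completionHom` (the global algebra
`T5AdicCompletionMap.instAlgebra`) and this seat's `completionMap` (file 115) are the same ring homomorphism —
both are continuous and agree with `algebraMap K L` on the dense image of `K`. -/
theorem algebraMap_eq_completionMap' :
    (algebraMap (v.adicCompletion F) (w.adicCompletion E) : v.adicCompletion F →+* w.adicCompletion E) =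
      T5FinitePlaceLiesOver.completionMap F E v w := by
  apply RingHom.ext
  refine congrFun (DenseRange.equalizer (denseRange_algebraMap F v) (continuous_algebraMap _ _)
    (T5FinitePlaceLiesOver.continuous_completionMap F E v w) (funext fun k => ?_))
  simp only [Function.comp_apply]
  rw [show algebraMap F (v.adicCompletion F) k = (k : v.adicCompletion F) from rfl, algebraMap_coe,
    T5FinitePlaceLiesOver.completionMap_coe]

/-- Pointwise form of the concordance. -/
theorem algebraMap_apply' (x : v.adicCompletion F) :
    algebraMap (v.adicCompletion F) (w.adicCompletion E) x = T5FinitePlaceLiesOver.completionMap F E v w x :=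
  DFunLike.congr_fun (algebraMap_eq_completionMap' v w) x

/-- The two `Algebra` structures of `L_w` over `Kᵥ` — p4's global one and this seat's scoped one — are equal. -/
theorem instAlgebra_eq :
    (T5AdicCompletionMap.instAlgebra F E v w : Algebra (v.adicCompletion F) (w.adicCompletion E)) =
      T5FinitePlaceLiesOver.instAlgebra F E v w :=
  Algebra.algebra_ext _ _ fun a => by
    rw [T5FinitePlaceLiesOver.algebraMap_eq_completionMap]
    exact algebraMap_apply' v w a

/-- **`[L_w : Kᵥ] = 2` for p4's algebra structure** at a non-split place (file 116 transported along
`instAlgebra_eq`). -/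
theorem finrank_eq_two' {s : E} {θ : F} (hs : s ^ 2 = algebraMap F E θ)
    (hspan : Submodule.span F {(1 : E), s} = ⊤) (hsq : ¬ IsSquare (algebraMap F (v.adicCompletion F) θ)) :
    finrank (v.adicCompletion F) (w.adicCompletion E) = 2 := by
  have key : ∀ i : Algebra (v.adicCompletion F) (w.adicCompletion E),
      i = T5FinitePlaceLiesOver.instAlgebra F E v w →
        @finrank (v.adicCompletion F) (w.adicCompletion E) _ _ i.toModule = 2 := by
    rintro i rfl
    exact (T5FinitePlaceQuadratic.finrank_eq_two_iff_not_isSquare v w hs hspan).mpr hsq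
  exact key (T5AdicCompletionMap.instAlgebra F E v w) (instAlgebra_eq v w)

end Concordance

section LocalConjugation

variable {F E : Type*} [Field F] [NumberField F] [Field E] [NumberField E] [Algebra F E]
  [Algebra.IsQuadraticExtension F E]
variable (v : HeightOneSpectrum (𝓞 F)) (w : HeightOneSpectrum (𝓞 E)) [w.asIdeal.LiesOver v.asIdeal]
variable {s : E} {θ : F}
variable (hs : s ^ 2 = algebraMap F E θ) (hspan : Submodule.span F {(1 : E), s} = ⊤)
  (hsq : ¬ IsSquare (algebraMap F (v.adicCompletion F) θ)) (c : E ≃ₐ[F] E) (hc : c s = -s)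

/-- File 117's local conjugation `extendAutOfNotIsSquare` as a ring automorphism of `L_w` (the `Kᵥ`-algebra
structure of file 115 forgotten). -/
noncomputable def localConjRingEquiv : (w.adicCompletion E) ≃+* (w.adicCompletion E) :=
  @AlgEquiv.toRingEquiv (v.adicCompletion F) (w.adicCompletion E) (w.adicCompletion E) _ _ _
    (T5FinitePlaceLiesOver.instAlgebra F E v w) (T5FinitePlaceLiesOver.instAlgebra F E v w)
    (extendAutOfNotIsSquare v w hs hspan hsq c)

/-- `localConjRingEquiv` is the local conjugation. -/
theorem localConjRingEquiv_apply (y : w.adicCompletion E) :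
    localConjRingEquiv v w hs hspan hsq c y = extendAutOfNotIsSquare v w hs hspan hsq c y := rfl

/-- File 117's local conjugation `extendAutOfNotIsSquare` as an automorphism of `L_w` over seat p4's
`Kᵥ`-algebra structure. -/
noncomputable def localConj : (w.adicCompletion E) ≃ₐ[v.adicCompletion F] (w.adicCompletion E) :=
  AlgEquiv.ofRingEquiv (f := localConjRingEquiv v w hs hspan hsq c) fun a => by
    rw [localConjRingEquiv_apply, algebraMap_apply' v w a]
    exact @AlgEquiv.commutes (v.adicCompletion F) (w.adicCompletion E) (w.adicCompletion E) _ _ _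
      (T5FinitePlaceLiesOver.instAlgebra F E v w) (T5FinitePlaceLiesOver.instAlgebra F E v w)
      (extendAutOfNotIsSquare v w hs hspan hsq c) a

/-- `localConj` is the local conjugation. -/
theorem localConj_apply (y : w.adicCompletion E) :
    localConj v w hs hspan hsq c y = extendAutOfNotIsSquare v w hs hspan hsq c y := rfl

/-- `localConj` is file 119's `star`. -/
theorem localConj_eq_star (y : w.adicCompletion E) :
    letI := localStarRing v w hs hspan hsq c hc
    localConj v w hs hspan hsq c y = star y := rfl

omit [NumberField E] [Algebra.IsQuadraticExtension F E] in
include hs hsq in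
/-- `√θ ≠ 0` in `E` (else `θ = 0` would be a `v`-adic square). -/
theorem s_ne_zero : s ≠ 0 := by
  rintro rfl
  apply hsq
  have hθ : θ = 0 := by
    have h := hs
    rw [zero_pow two_ne_zero] at h
    exact (map_eq_zero _).mp h.symm
  exact ⟨0, by rw [hθ, map_zero, mul_zero]⟩

include hc in
/-- `localConj ≠ 1`: it sends the image of `√θ` to its negative. -/
theorem localConj_ne_one : localConj v w hs hspan hsq c ≠ 1 := by
  intro h
  haveI : CharZero (w.adicCompletion E) :=
    charZero_of_injective_algebraMap (algebraMap ℚ (w.adicCompletion E)).injective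
  have h1 := DFunLike.congr_fun h (algebraMap E (w.adicCompletion E) s)
  simp only [localConj_apply, AlgEquiv.one_apply] at h1
  rw [extendAutOfNotIsSquare_apply_s v w hs hspan hsq c hc, CharZero.neg_eq_self_iff, map_eq_zero] at h1
  exact s_ne_zero v hs hsq h1

/-- Star-fixed elements of `E_w` come from `Kᵥ` through p4's structure map (file 119's `star_eq_self_iff`, in
p4's vocabulary). -/
theorem exists_algebraMap_eq_of_star_eq_self {y : w.adicCompletion E}
    (hy : letI := localStarRing v w hs hspan hsq c hc; star y = y) :
    ∃ x : v.adicCompletion F, algebraMap (v.adicCompletion F) (w.adicCompletion E) x = y := by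
  obtain ⟨x, hx⟩ := (star_eq_self_iff v w hs hspan hsq c hc y).1 hy
  exact ⟨x, by rw [algebraMap_apply']; exact hx⟩

/-- The image of `Kᵥ` is star-fixed (file 119's `star_algebraMap_left`, in p4's vocabulary). -/
theorem star_algebraMap_left' (x : v.adicCompletion F) :
    letI := localStarRing v w hs hspan hsq c hc
    star (algebraMap (v.adicCompletion F) (w.adicCompletion E) x) =
      algebraMap (v.adicCompletion F) (w.adicCompletion E) x := by
  rw [← localConj_eq_star v w hs hspan hsq c hc]
  exact (localConj v w hs hspan hsq c).commutes x

/-- **File 134's `IsUnitNorm` is membership in p4's norm group:** for a unit `y` of `Kᵥ`, `alg y = star u · u`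
for a unit `u` of `E_w` iff `y ∈ normGroup v w localConj`. -/
theorem isUnitNorm_iff_mem_normGroup (y : (v.adicCompletion F)ˣ) :
    letI := localStarRing v w hs hspan hsq c hc
    IsUnitNorm (algebraMap (v.adicCompletion F) (w.adicCompletion E) (y : v.adicCompletion F)) ↔
      y ∈ normGroup v w (localConj v w hs hspan hsq c) := by
  letI := localStarRing v w hs hspan hsq c hc
  rw [mem_normGroup_iff]
  constructor
  · rintro ⟨u, _, h⟩
    exact ⟨u, by rw [localConj_eq_star v w hs hspan hsq c hc, mul_comm, ← h]⟩
  · rintro ⟨x, hx⟩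
    refine ⟨x, ?_, ?_⟩
    · rw [isUnit_iff_ne_zero]
      rintro rfl
      rw [zero_mul, eq_comm, map_eq_zero] at hx
      exact y.ne_zero hx
    · rw [← hx, localConj_eq_star v w hs hspan hsq c hc, mul_comm]

/-- **`IndexTwo E_w` — `(F_v^× : N E_w^×) = 2` in file 140's elementary form** at every finite non-split place:
the product of two star-fixed non-zero non-norms of `E_w` is a norm. From seat p4's local norm index theorem
`T5LocalNormIndex.index_normGroup_eq_two` (inert: `T5AdicCompletionNormGroup`; ramified, any residue
characteristic: `T5QuadraticNormIndex`), applied to `localConj` with `[E_w : F_v] = 2`. -/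
theorem indexTwo :
    letI := localStarRing v w hs hspan hsq c hc
    IndexTwo (w.adicCompletion E) := by
  letI := localStarRing v w hs hspan hsq c hc
  have hidx := index_normGroup_eq_two v w (localConj v w hs hspan hsq c) (finrank_eq_two' v w hs hspan hsq)
    (localConj_ne_one v w hs hspan hsq c hc)
  intro a b ha hb ha0 hb0 hna hnb
  obtain ⟨ya, rfl⟩ := exists_algebraMap_eq_of_star_eq_self v w hs hspan hsq c hc ha
  obtain ⟨yb, rfl⟩ := exists_algebraMap_eq_of_star_eq_self v w hs hspan hsq c hc hb
  have hya : ya ≠ 0 := fun h => ha0 (by rw [h, map_zero])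
  have hyb : yb ≠ 0 := fun h => hb0 (by rw [h, map_zero])
  have hma : Units.mk0 ya hya ∉ normGroup v w (localConj v w hs hspan hsq c) := fun h =>
    hna ((isUnitNorm_iff_mem_normGroup v w hs hspan hsq c hc (Units.mk0 ya hya)).2 h)
  have hmb : Units.mk0 yb hyb ∉ normGroup v w (localConj v w hs hspan hsq c) := fun h =>
    hnb ((isUnitNorm_iff_mem_normGroup v w hs hspan hsq c hc (Units.mk0 yb hyb)).2 h)
  have hab : Units.mk0 ya hya * Units.mk0 yb hyb ∈ normGroup v w (localConj v w hs hspan hsq c) :=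
    (Subgroup.mul_mem_iff_of_index_two hidx).2 (iff_of_false hma hmb)
  have h := (isUnitNorm_iff_mem_normGroup v w hs hspan hsq c hc _).2 hab
  rwa [Units.val_mul, Units.val_mk0, Units.val_mk0, map_mul] at h

/-- A star-fixed non-zero non-norm exists in `E_w` (`normGroup ≠ ⊤`): the hypothesis `a₀` of file 140's
theorems is not vacuous at any finite non-split place. -/
theorem exists_star_eq_self_not_isUnitNorm :
    letI := localStarRing v w hs hspan hsq c hc
    ∃ a₀ : w.adicCompletion E, star a₀ = a₀ ∧ a₀ ≠ 0 ∧ ¬ IsUnitNorm a₀ := by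
  letI := localStarRing v w hs hspan hsq c hc
  have hne := normGroup_ne_top v w (localConj v w hs hspan hsq c) (finrank_eq_two' v w hs hspan hsq)
    (localConj_ne_one v w hs hspan hsq c hc)
  obtain ⟨y, hy⟩ : ∃ y, y ∉ normGroup v w (localConj v w hs hspan hsq c) := by
    by_contra h
    exact hne ((Subgroup.eq_top_iff' _).2 fun y => by_contra fun hy => h ⟨y, hy⟩)
  refine ⟨algebraMap (v.adicCompletion F) (w.adicCompletion E) y, star_algebraMap_left' v w hs hspan hsq c hc y,
    (map_ne_zero _).2 y.ne_zero, fun h => hy ((isUnitNorm_iff_mem_normGroup v w hs hspan hsq c hc y).1 h)⟩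

/-- **HKS96's «precisely two isomorphism classes in each dimension» on the route's `E_w`, modulo `(U)` alone:**
for every `m`, two invertible hermitian `(m+1) × (m+1)` matrices over `E_w`, not congruent to each other, such
that every invertible hermitian matrix is congruent to one of them (file 140's `exists_two_representatives` with
`IndexTwo E_w` discharged by `indexTwo` and the non-norm `a₀` by `exists_star_eq_self_not_isUnitNorm`). -/
theorem exists_two_classes_local
    (hU : letI := localStarRing v w hs hspan hsq c hc; BinaryUniversal (w.adicCompletion E)) (m : ℕ) :
    letI := localStarRing v w hs hspan hsq c hc
    ∃ H₁ H₂ : Matrix (Fin (m + 1)) (Fin (m + 1)) (w.adicCompletion E),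
      H₁.IsHermitian ∧ H₂.IsHermitian ∧ IsUnit H₁.det ∧ IsUnit H₂.det ∧ ¬ IsCongruent H₁ H₂ ∧
        ∀ H : Matrix (Fin (m + 1)) (Fin (m + 1)) (w.adicCompletion E), H.IsHermitian → IsUnit H.det →
          IsCongruent H H₁ ∨ IsCongruent H H₂ := by
  letI := localStarRing v w hs hspan hsq c hc
  obtain ⟨a₀, h1, h2, h3⟩ := exists_star_eq_self_not_isUnitNorm v w hs hspan hsq c hc
  exact exists_two_representatives (exists_add_star_ne_zero_local v w hs hspan hsq c hc) hU
    (indexTwo v w hs hspan hsq c hc) h1 h2 h3 m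

end LocalConjugation

end Summit.Ventures.HodgeRepro2.T5FinitePlaceNormIndex
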